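import Summits.BirchSwinnertonDyer.Rank1Residual.AdditivePotMult.RankOneShaCertificate
import Literature.NumberTheory.EllipticCurves.MatarNekovar2019.ShaIndexBoundIrreducible
import HarnessLib

/-!
# Rank ONE at an additive (indeed ANY bad) odd prime: the Heegner-index VALUATION plus a finite
# `Ш`-certificate under IRREDUCIBILITY of `E[p]` ONLY (cell `b2b-bsdres`, sub-cell additive-p1, gen 13)

HONEST FRAMING (cell `b2b-bsdres`, run/shared/lean/b2b/bsd-rank1-residual/, verbatim in every
file): the goal of the cell is to DELETE the COMBINATION-SHAPED residual classes of the
Birch–Swinnerton-Dyer formula for ALL analytic-rank `≤ 1` elliptic curves over `ℚ` — "full BSD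
formula for every rank `≤ 1` curve in class `C`" assembled STRICTLY from published theorems — so
that the rank-`≤ 1` remainder becomes exactly the CONSTRUCTION-SHAPED classes, which are TYPED
(missing-input `Prop`s), NOT attempted. This is not "finishing BSD". Sub-cell additive-p1 is a
RESEARCH ROUTE on the construction-shaped classes X3♯(M) / X4(M) (additive, potentially
multiplicative `p`); no claim beyond the stated sub-classes; X3/X4 labels are UNCHANGED by this file;
NOTHING is booked here (a per-pair closure is the referee's ruling on the lane's certificates).

THEOREMS ONLY (no definition, no named fact). PER PAIR, not a class theorem.

## What this file records

Gen 12's `RankOneShaCertificate.lean` (p244357) reads the certificate `ord_p [E(K):ℤP] ≤ k` ∧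
`p^{2k−1} ∣ #Ш(E)` ∧ unit twist value ∧ `p ∤ ∏c(E)` at a rank-one pair into `BSD(E,p) ∧ BSD(E^{d_K},p)`
through Kolyvagin's QUANTITATIVE bound in McCallum's form (`ord_p #Ш(E/K) ≤ 2·ord_p [E(K):ℤy_K]`,
`p` odd, `ρ̄_{E,p}` ONTO), so its readings on X4(M) carry the binder `Surj W p`. Surjectivity is NOT
needed: the tree's PUBLISHED named fact `MatarNekovar2019.thm03_padicValNat_card_sha_le_of_irreducible`
(`ShaIndexBoundIrreducible.lean`, p207298, cell row A91: Matar–Nekovář, JTNB 31 (2019), Thm. 0.3 =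
Kolyvagin 1990 Cor. 13 with its condition (a) discharged by their Cor. 5.21 (e′) / Prop. 5.26 (2),
§0.4, §0.11; flags `MN19-0.11-composite`, `Kolyvagin1990-Cor13-primary-unread` travel with it) states
the SAME bound for `p` odd, `E[p]` an IRREDUCIBLE `𝔽_p[G_ℚ]`-module, `d_K ≠ −3, −4` — no
surjectivity, no `p ∤ D_K`, no condition on the reduction at `p`. This file is the image-free form of
gen 12's file: `hB` ↦ `hMN`, `Surj` ↦ `Irr` (part of `ClassX4`), `d_K < −4` supplying `d_K ≠ −3, −4`.
The `k = 0` case (exact certificate) is the sibling `RankOneIrreducibleIndexCertificate.lean`, which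
uses the in-body Thm. 6.7 (1) (cell row A58) instead.

What moves (REPORT §18): the rank-one X4(M) pairs with `E[p]` irreducible, `ρ̄_{E,p}` NOT surjective
and `p ∣ #Ш_an(E)` get the valuation lever (before: none); the readings `…_of_surj` of gen 12 are
superseded as to the image by `ClassX4M.bsdp_rankOne_of_indexValuation_of_pow_dvd` below.

* §1 data level (any level `N`, any odd `p`, `d_K ≠ −3, −4`):
  `missingPPartAt_and_twist_of_indexValuation_of_pow_dvd_of_irr`.
* §2 conductor level (`p ∣ N_E` odd, `d_K < −4`): `bsdp_of_rankOne_of_indexValuation_of_pow_dvd_of_dvd_of_irr`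
  (pair, any `d_K`), `bsdp_and_bsdp_twist_of_indexValuation_of_pow_dvd_of_odd_of_irr` (pair AND twist,
  `d_K` odd).
* §3 readings, NO image hypothesis: `ClassX4M.bsdp_rankOne_of_indexValuation_of_pow_dvd`,
  `ClassX4M.bsdp_rankOne_of_indexValuation_of_exists_torsion` (`k = 1`).

References: [MatarNekovar2019] Thm. 0.3, §0.4, §0.11, Cor. 5.21, Prop. 5.26; [KolyvaginEulerSystems1990]
Cor. 13; [SilvermanAEC2009] Thm. X.4.14 (Cassels); [JetchevSkinnerWan2017] §7.4; [Miller2011LMS]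
Def. 1.1; [SilvermanATAEC1994] IV.9.4 Table 4.1.
-/

noncomputable section

open scoped Classical NumberField

open WeierstrassCurve NumberField Literature.NumberTheory.EllipticCurves
  Literature.NumberTheory.EllipticCurves.ModularForms
  Literature.NumberTheory.EllipticCurves.Rank1Residual
  Literature.NumberTheory.EllipticCurves.Rank1Residual.Typed
  Literature.NumberTheory.EllipticCurves.KrizLi2019
  Literature.NumberTheory.QuadraticFields
  Literature.NumberTheory.Automorphic
  IsDedekindDomain

namespace Summit.BirchSwinnertonDyer.Rank1Residual.AdditivePotMult

/-! ### §1 Data level, any odd `p`, any level: index valuation `≤ k` + `p^{2k-1} ∣ #Ш(E)`, `E[p]` irreducible -/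

/-- **Rank one, ANY odd `p`, `E[p]` IRREDUCIBLE (no surjectivity), any reduction type: the typed output
`MissingPPartAt W p` AND `ord_p #Ш(Wd) = 0` for the Heegner twist, from the index VALUATION and a
`Ш`-certificate.** Data: `W/ℚ` globally minimal, `ord_{s=1} L(E,s) = 1`; `K` imaginary quadratic with
the Heegner hypothesis for the level `N`, `d_K ≠ −3, −4`; `P ∈ E(K)` the Heegner point of a
parametrisation datum `Dt` with `p ∤ c(Dt)`; `p ∤ #𝓞_K^×`; `Wd = Cd • W^{(d_K)}` globally minimal with
`ord_p u(Cd) = 0`; `q_d = L(Wd,1)/Ω(Wd) ≠ 0` with `ord_p q_d = 0`; `p ∤ ∏_ℓ c_ℓ(E)`. CERTIFICATE: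
`ord_p [E(K):ℤP] ≤ k` and `p^{2k−1} ∣ #Ш(E/ℚ)`. Proof = gen 12's
`missingPPartAt_and_twist_of_indexValuation_of_pow_dvd` with Kolyvagin's bound taken from
Matar–Nekovář's irreducible-image form (`hMN`) instead of McCallum's surjective one: the identity gives
`ord_p #Ш(E)_an = 2·ord_p [E(K):ℤP] ≤ 2k` and `ord_p #Ш(E/K) = ord_p #Ш(E) + ord_p #Ш(Wd)`; `hMN`
gives `ord_p #Ш(E/K) ≤ 2·ord_p [E(K):ℤP]`; Cassels–Tate (`hCT`) and the certificate give
`2k ≤ ord_p #Ш(E)`. Per pair; nothing booked.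
[cite: MatarNekovar2019, Thm. 0.3 (p. 456), §0.11 (p. 457), Cor. 5.21 (e′), Prop. 5.26 (2)]
[cite: SilvermanAEC2009, Thm. X.4.14] [cite: JetchevSkinnerWan2017, §7.4.1 (eq:gz for K′), p. 30]
[cite: Miller2011LMS, §1 and Def. 1.1] -/
theorem missingPPartAt_and_twist_of_indexValuation_of_pow_dvd_of_irr
    (W : WeierstrassCurve ℚ) [W.IsElliptic] [W.IsGloballyMinimal] (p : ℕ) [Fact p.Prime]
    (N : ℕ) [NeZero N] (K : Type) [Field K] [NumberField K]
    (Dt : ModularParametrizationData W N) (H : HeegnerDatum N (NumberField.discr K)) (ι : K →+* ℂ)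
    (P : (W.baseChange K).toAffine.Point)
    -- the published inputs (named facts of the tree)
    (hGZ : gross_zagier N W K) (hKo : kolyvagin N W K)
    (hMN : MatarNekovar2019.thm03_padicValNat_card_sha_le_of_irreducible N W K)
    (hGZK : rank_eq_analyticRank_of_analyticRank_le_one) (hmod : hasEntireLFunction_rat)
    (hCT : exists_casselsTate_pairing (K := ℚ))
    -- the pair and the Heegner data
    (hK : IsImaginaryQuadratic K) (hHN : SatisfiesHeegnerHypothesis N K)
    (hD3 : NumberField.discr K ≠ -3) (hD4 : NumberField.discr K ≠ -4)
    (hP : WeierstrassCurve.Affine.Point.map ι.toRatAlgHom P = heegnerPointComplex Dt H)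
    (hp2 : p ≠ 2) (hc : ¬ (p : ℤ) ∣ Dt.c) (hμ : ¬ p ∣ Units.torsionOrder K)
    (hr : W.analyticRank = 1) (hirr : Irr W p)
    (Wd : WeierstrassCurve ℚ) [Wd.IsElliptic] [Wd.IsGloballyMinimal] (Cd : VariableChange ℚ)
    (hWd : Cd • W.quadraticTwist (NumberField.discr K : ℚ) = Wd)
    (hu : padicValRat p (Cd.u : ℚ) = 0)
    -- the twist's algebraic central value (a datum), a `p`-unit
    (qd : ℚ) (hqd : Wd.entireLFunction 1 / (Wd.realPeriodRat : ℂ) = (qd : ℂ)) (hqd0 : qd ≠ 0)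
    (hvd : padicValRat p qd = 0) (htam : ¬ p ∣ W.tamagawaProduct)
    -- the certificate: index valuation `≤ k` and `p^{2k-1} ∣ #Ш(E/ℚ)`
    {k : ℕ} (hI : padicValNat p (AddSubgroup.zmultiples P).index ≤ k)
    (hdvd : p ^ (2 * k - 1) ∣ W.shaOrder) :
    MissingPPartAt W p ∧ padicValNat p Wd.shaOrder = 0 := by
  have hp : p.Prime := Fact.out
  have hD0 : (NumberField.discr K : ℚ) ≠ 0 := by exact_mod_cast NumberField.discr_ne_zero K
  haveI hEt : (W.quadraticTwist (NumberField.discr K : ℚ)).IsElliptic :=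
    W.isElliptic_quadraticTwist hD0
  -- the twist's central value is non-zero
  have hLt' : (W.quadraticTwist (NumberField.discr K : ℚ)).entireLFunction = Wd.entireLFunction := by
    rw [← hWd, entireLFunction_smul]
  have hLt : (W.quadraticTwist (NumberField.discr K : ℚ)).entireLFunction 1 ≠ 0 := by
    rw [hLt']
    intro h0
    apply hqd0
    have : ((qd : ℂ)) = 0 := by rw [← hqd, h0, zero_div]
    exact_mod_cast this
  -- the twist has no rational `p`-torsion
  have hirrd : Wd.HasIrreducibleModPGaloisRep p :=
    X11b.hasIrreducibleModPGaloisRep_twist_model W p K hK.1 hirr Cd hWd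
  have htors : padicValNat p Wd.torsionOrder = 0 :=
    padicValNat_torsionOrder_eq_zero_of_irreducible Wd p hirrd
  -- the identity: finiteness, the `Ш` decomposition over `K`, and the valuation of `#Ш_an`
  obtain ⟨hfinW, hfinK, hsum, q, hq, hid⟩ :=
    X11b.exists_shaAn_padicVal_eq_of_heegner W p N K Dt H ι P hGZ hKo hGZK hmod hK hHN hP hp2 hc hμ
      hr hLt Wd Cd hWd hu qd hqd
  rw [hvd, htors, padicValNat.eq_zero_of_not_dvd htam] at hid
  -- `ord_p #Ш_an(E) = 2 ord_p [E(K):ℤP]`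
  have hvq : padicValRat p q = 2 * (padicValNat p (AddSubgroup.zmultiples P).index : ℤ) := by
    have := hid; push_cast at this ⊢; linarith
  -- the Heegner point is non-torsion; Matar–Nekovář's form of Kolyvagin's bound
  have hPH : IsHeegnerPoint N W K P := ⟨Dt, H, ι, hP⟩
  have hL0 : W.entireLFunction 1 = 0 := entireLFunction_one_eq_zero_of_analyticRank_eq_one hr
  obtain ⟨-, hderiv⟩ := leadingLCoeff_eq_deriv_of_analyticRank_eq_one hr
  have hLK : LDerivEK W K ≠ 0 := by
    rw [lDerivEK_eq_deriv_mul W K hmod hL0]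
    exact mul_ne_zero hderiv hLt
  have hnt : ¬ IsOfFinAddOrder P :=
    (lDerivEK_ne_zero_iff_not_isOfFinAddOrder W N K hGZ hK hHN hPH).mp hLK
  have hKsha : padicValNat p (W.baseChange K).shaOrder ≤
      2 * padicValNat p (AddSubgroup.zmultiples P).index := hMN hK hHN hD3 hD4 hPH hnt hp hp2 hirr
  -- Cassels–Tate squareness and the certificate: `2k ≤ ord_p #Ш(E)`
  have hfin : W.ShaFinite := hfinW
  have hsq : IsSquare W.shaOrder := isSquare_shaOrder_of_casselsTate hCT W hfin
  have hn : W.shaOrder ≠ 0 := (WeierstrassCurve.shaOrder_pos W hfin).ne'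
  have hle : 2 * k ≤ padicValNat p W.shaOrder :=
    two_mul_le_padicValNat_of_isSquare_of_pow_dvd hsq hn hdvd
  -- assembly: `ord_p #Ш(E) + ord_p #Ш(Wd) ≤ 2 ord_p I ≤ 2k ≤ ord_p #Ш(E)`
  have he : padicValNat p W.shaOrder = 2 * padicValNat p (AddSubgroup.zmultiples P).index := by omega
  have hf : padicValNat p Wd.shaOrder = 0 := by omega
  refine ⟨⟨q, hq, ?_⟩, hf⟩
  rw [hvq, he]
  push_cast
  ring

/-! ### §2 Conductor level, `p ∣ N_E` odd, `d_K < -4` -/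

/-- **Rank one, ANY odd `p ∣ N_E` (additive included), `E[p]` IRREDUCIBLE, any Heegner field with
`d_K < −4`: `BSD(E,p)` from the index valuation `≤ k` and the certificate `p^{2k−1} ∣ #Ш(E/ℚ)`**
(`ord_p u(Cd) = 0` for the minimal twist model because `p ∣ N_E` splits in `K`; `p ∤ w_K = 2`;
`d_K < −4` gives `d_K ≠ −3, −4`). CERTIFICATE: `q_d = L(E^{d_K},1)/Ω(Wd) ≠ 0` with `ord_p q_d = 0`,
`p ∤ ∏_ℓ c_ℓ(E)`, `p ∤ c(Dt)`, `ord_p [E(K):ℤP] ≤ k`, `p^{2k−1} ∣ #Ш(E)`. Image-free form of gen 12's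
`bsdp_of_rankOne_of_indexValuation_of_pow_dvd_of_dvd`. Per pair; nothing booked.
[cite: MatarNekovar2019, Thm. 0.3 (p. 456), §0.11 (p. 457)] [cite: SilvermanAEC2009, Thm. X.4.14]
[cite: Miller2011LMS, Def. 1.1] -/
theorem bsdp_of_rankOne_of_indexValuation_of_pow_dvd_of_dvd_of_irr
    (W : WeierstrassCurve ℚ) [W.IsElliptic] [W.IsGloballyMinimal] (p : ℕ) [Fact p.Prime]
    [NeZero (W.conductorNorm ℤ)] (K : Type) [Field K] [NumberField K]
    (Dt : ModularParametrizationData W (W.conductorNorm ℤ))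
    (H : HeegnerDatum (W.conductorNorm ℤ) (NumberField.discr K)) (ι : K →+* ℂ)
    (P : (W.baseChange K).toAffine.Point)
    (hGZ : gross_zagier (W.conductorNorm ℤ) W K) (hKo : kolyvagin (W.conductorNorm ℤ) W K)
    (hMN : MatarNekovar2019.thm03_padicValNat_card_sha_le_of_irreducible (W.conductorNorm ℤ) W K)
    (hGZK : rank_eq_analyticRank_of_analyticRank_le_one) (hmod : hasEntireLFunction_rat)
    (hCT : exists_casselsTate_pairing (K := ℚ))
    (hp2 : p ≠ 2) (hpN : p ∣ W.conductorNorm ℤ) (hr : W.analyticRank = 1) (hirr : Irr W p)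
    (hK : IsImaginaryQuadratic K) (hHN : SatisfiesHeegnerHypothesis (W.conductorNorm ℤ) K)
    (hdK : NumberField.discr K < -4)
    (hP : WeierstrassCurve.Affine.Point.map ι.toRatAlgHom P = heegnerPointComplex Dt H)
    (hc : ¬ (p : ℤ) ∣ Dt.c)
    (Wd : WeierstrassCurve ℚ) [Wd.IsElliptic] [Wd.IsGloballyMinimal] (Cd : VariableChange ℚ)
    (hWd : Cd • W.quadraticTwist (NumberField.discr K : ℚ) = Wd)
    (qd : ℚ) (hqd : Wd.entireLFunction 1 / (Wd.realPeriodRat : ℂ) = (qd : ℂ)) (hqd0 : qd ≠ 0)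
    (hvd : padicValRat p qd = 0) (htam : ¬ p ∣ W.tamagawaProduct)
    {k : ℕ} (hI : padicValNat p (AddSubgroup.zmultiples P).index ≤ k)
    (hdvd : p ^ (2 * k - 1) ∣ W.shaOrder) : BSDp W p := by
  have hp : p.Prime := Fact.out
  have hμ : ¬ p ∣ Units.torsionOrder K := by
    rw [Literature.NumberTheory.DiophantineGeometry.torsionOrder_eq_two_of_discr_lt hK.1 hdK]
    intro h2
    exact hp2 ((Nat.prime_dvd_prime_iff_eq hp Nat.prime_two).mp h2)
  have hu : padicValRat p (Cd.u : ℚ) = 0 :=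
    padicValRat_u_eq_zero_of_twist_minimal_of_dvd W p K hK hHN hpN Cd hWd
  have hD3 : NumberField.discr K ≠ -3 := by omega
  have hD4 : NumberField.discr K ≠ -4 := by omega
  exact bsdp_of_missingPPartAt W p hGZK (by rw [hr])
    (missingPPartAt_and_twist_of_indexValuation_of_pow_dvd_of_irr W p (W.conductorNorm ℤ) K Dt H ι P
      hGZ hKo hMN hGZK hmod hCT hK hHN hD3 hD4 hP hp2 hc hμ hr hirr Wd Cd hWd hu qd hqd hqd0 hvd htam hI
      hdvd).1

/-- **Rank one, ANY odd `p ∣ N_E`, `E[p]` IRREDUCIBLE, Heegner field with `d_K` ODD and `d_K < −4`: the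
index valuation `≤ k` and the certificate `p^{2k−1} ∣ #Ш(E/ℚ)` close BOTH the pair and its rank-zero
Heegner twist at `p`** — `BSDp W p ∧ BSDp Wd p`. The twist: §1 gives `ord_p #Ш(Wd) = 0`; eisenstein-p2's
odd-`d_K` Tamagawa transport `X2.padicValNat_tamagawaProduct_twist_of_heegner_of_odd` (type `I₀*` at
`ℓ ∣ d_K`; `p ∤ d_K` because `p ∣ N_E` splits in `K`) gives `p ∤ ∏c_ℓ(Wd)`; the twist inherits
irreducibility, so no rational `p`-torsion; the rank-zero print shape (`bsdp_of_pPartRankZero`)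
finishes with `ord_p q_d = 0`. Image-free form of gen 12's
`bsdp_and_bsdp_twist_of_indexValuation_of_pow_dvd_of_odd`. Per pair; nothing booked; class-agnostic.
[cite: MatarNekovar2019, Thm. 0.3 (p. 456), §0.11 (p. 457)] [cite: SilvermanAEC2009, Thm. X.4.14]
[cite: JetchevSkinnerWan2017, §7.4 (pp. 29–31)] [cite: SilvermanATAEC1994, IV.9.4 Table 4.1]
[cite: Miller2011LMS, Def. 1.1] -/
theorem bsdp_and_bsdp_twist_of_indexValuation_of_pow_dvd_of_odd_of_irr
    (W : WeierstrassCurve ℚ) [W.IsElliptic] [W.IsGloballyMinimal] (p : ℕ) [Fact p.Prime]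
    [NeZero (W.conductorNorm ℤ)] (K : Type) [Field K] [NumberField K]
    (Dt : ModularParametrizationData W (W.conductorNorm ℤ))
    (H : HeegnerDatum (W.conductorNorm ℤ) (NumberField.discr K)) (ι : K →+* ℂ)
    (P : (W.baseChange K).toAffine.Point)
    -- the published inputs (named facts of the tree)
    (hGZ : gross_zagier (W.conductorNorm ℤ) W K) (hKo : kolyvagin (W.conductorNorm ℤ) W K)
    (hMN : MatarNekovar2019.thm03_padicValNat_card_sha_le_of_irreducible (W.conductorNorm ℤ) W K)
    (hGZK : rank_eq_analyticRank_of_analyticRank_le_one) (hmod : hasEntireLFunction_rat)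
    (hCT : exists_casselsTate_pairing (K := ℚ))
    -- the pair and the Heegner data
    (hp2 : p ≠ 2) (hpN : p ∣ W.conductorNorm ℤ) (hr : W.analyticRank = 1) (hirr : Irr W p)
    (hK : IsImaginaryQuadratic K) (hHN : SatisfiesHeegnerHypothesis (W.conductorNorm ℤ) K)
    (hodd : Odd (NumberField.discr K)) (hdK : NumberField.discr K < -4)
    (hP : WeierstrassCurve.Affine.Point.map ι.toRatAlgHom P = heegnerPointComplex Dt H)
    (hc : ¬ (p : ℤ) ∣ Dt.c)
    (Wd : WeierstrassCurve ℚ) [Wd.IsElliptic] [Wd.IsGloballyMinimal] (Cd : VariableChange ℚ)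
    (hWd : Cd • W.quadraticTwist (NumberField.discr K : ℚ) = Wd)
    -- the twist value (a `p`-unit), `p ∤ ∏c`, and the certificate
    (qd : ℚ) (hqd : Wd.entireLFunction 1 / (Wd.realPeriodRat : ℂ) = (qd : ℂ)) (hqd0 : qd ≠ 0)
    (hvd : padicValRat p qd = 0) (htam : ¬ p ∣ W.tamagawaProduct)
    {k : ℕ} (hI : padicValNat p (AddSubgroup.zmultiples P).index ≤ k)
    (hdvd : p ^ (2 * k - 1) ∣ W.shaOrder) :
    BSDp W p ∧ BSDp Wd p := by
  have hp : p.Prime := Fact.out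
  -- `w_K = 2`, prime to the odd `p`; `ord_p u = 0`; `p ∤ d_K`; `d_K ≠ -3, -4`
  have hμ : ¬ p ∣ Units.torsionOrder K := by
    rw [Literature.NumberTheory.DiophantineGeometry.torsionOrder_eq_two_of_discr_lt hK.1 hdK]
    intro h2
    exact hp2 ((Nat.prime_dvd_prime_iff_eq hp Nat.prime_two).mp h2)
  have hu : padicValRat p (Cd.u : ℚ) = 0 :=
    padicValRat_u_eq_zero_of_twist_minimal_of_dvd W p K hK hHN hpN Cd hWd
  have hpd : ¬ (p : ℤ) ∣ NumberField.discr K :=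
    Literature.SatisfiesHeegnerHypothesis.not_dvd_discr hK.1 hHN hp hpN
  have hD3 : NumberField.discr K ≠ -3 := by omega
  have hD4 : NumberField.discr K ≠ -4 := by omega
  obtain ⟨hmiss, hshad⟩ :=
    missingPPartAt_and_twist_of_indexValuation_of_pow_dvd_of_irr W p (W.conductorNorm ℤ) K Dt H ι P
      hGZ hKo hMN hGZK hmod hCT hK hHN hD3 hD4 hP hp2 hc hμ hr hirr Wd Cd hWd hu qd hqd hqd0 hvd htam hI
      hdvd
  refine ⟨bsdp_of_missingPPartAt W p hGZK (by rw [hr]) hmiss, ?_⟩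
  ---------------------------------------------------------------- the twist
  have hD0 : (NumberField.discr K : ℚ) ≠ 0 := by exact_mod_cast NumberField.discr_ne_zero K
  haveI hEt : (W.quadraticTwist (NumberField.discr K : ℚ)).IsElliptic :=
    W.isElliptic_quadraticTwist hD0
  have hLt' : (W.quadraticTwist (NumberField.discr K : ℚ)).entireLFunction = Wd.entireLFunction := by
    rw [← hWd, entireLFunction_smul]
  have hLd1 : Wd.entireLFunction 1 ≠ 0 := by
    intro h0
    apply hqd0
    have : ((qd : ℂ)) = 0 := by rw [← hqd, h0, zero_div]
    exact_mod_cast this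
  have hrd : Wd.analyticRank = 0 := (Wd.analyticRank_eq_zero_iff_holds (hmod Wd)).2 hLd1
  have hirrd : Wd.HasIrreducibleModPGaloisRep p :=
    X11b.hasIrreducibleModPGaloisRep_twist_model W p K hK.1 hirr Cd hWd
  have htors : padicValNat p Wd.torsionOrder = 0 :=
    padicValNat_torsionOrder_eq_zero_of_irreducible Wd p hirrd
  have htamd : padicValNat p Wd.tamagawaProduct = 0 := by
    rw [X2.padicValNat_tamagawaProduct_twist_of_heegner_of_odd W p hp2 K hK hodd hpd hHN Cd hWd]
    exact padicValNat.eq_zero_of_not_dvd htam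
  -- the rank-zero print shape for the twist
  refine bsdp_of_pPartRankZero Wd p hmod hGZK hrd ⟨qd, hqd, ?_⟩
  rw [hvd, hshad, htamd, htors]
  simp

/-! ### §3 This sub-cell: X4(M) rank-one pairs at every odd `p`, NO image hypothesis -/

variable {W : WeierstrassCurve ℚ} [W.IsElliptic] {p : ℕ} [Fact p.Prime]

/-- **X4(M), rank one, ANY odd `p` — NO image hypothesis: `BSD(E,p)` and `BSD(E^{d_K},p)` from the
index valuation `≤ k` at a Heegner field with odd `d_K < −4`, the unit twist value, `p ∤ ∏c_ℓ(E)` and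
the certificate `p^{2k−1} ∣ #Ш(E/ℚ)`** (`Irr W p` is part of `ClassX4 W p`; `p ∣ N_E` because `p` is
additive). Supersedes gen 12's `ClassX4M.bsdp_rankOne_of_indexValuation_of_pow_dvd_of_surj` /
`…_of_not_dvd_padicValRat_j` as to the image. Per pair; X4(M) stays CONSTRUCTION-SHAPED; nothing booked.
[cite: MatarNekovar2019, Thm. 0.3 (p. 456), §0.11 (p. 457)] [cite: SilvermanAEC2009, Thm. X.4.14]
[cite: Miller2011LMS, Def. 1.1] -/
theorem ClassX4M.bsdp_rankOne_of_indexValuation_of_pow_dvd [W.IsGloballyMinimal]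
    [NeZero (W.conductorNorm ℤ)]
    (hX : ClassX4M W p) (hr : W.analyticRank = 1)
    (K : Type) [Field K] [NumberField K]
    (Dt : ModularParametrizationData W (W.conductorNorm ℤ))
    (H : HeegnerDatum (W.conductorNorm ℤ) (NumberField.discr K)) (ι : K →+* ℂ)
    (P : (W.baseChange K).toAffine.Point)
    (hGZ : gross_zagier (W.conductorNorm ℤ) W K) (hKo : kolyvagin (W.conductorNorm ℤ) W K)
    (hMN : MatarNekovar2019.thm03_padicValNat_card_sha_le_of_irreducible (W.conductorNorm ℤ) W K)
    (hGZK : rank_eq_analyticRank_of_analyticRank_le_one) (hmod : hasEntireLFunction_rat)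
    (hCT : exists_casselsTate_pairing (K := ℚ))
    (hK : IsImaginaryQuadratic K) (hHN : SatisfiesHeegnerHypothesis (W.conductorNorm ℤ) K)
    (hodd : Odd (NumberField.discr K)) (hdK : NumberField.discr K < -4)
    (hP : WeierstrassCurve.Affine.Point.map ι.toRatAlgHom P = heegnerPointComplex Dt H)
    (hc : ¬ (p : ℤ) ∣ Dt.c)
    (Wd : WeierstrassCurve ℚ) [Wd.IsElliptic] [Wd.IsGloballyMinimal] (Cd : VariableChange ℚ)
    (hWd : Cd • W.quadraticTwist (NumberField.discr K : ℚ) = Wd)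
    (qd : ℚ) (hqd : Wd.entireLFunction 1 / (Wd.realPeriodRat : ℂ) = (qd : ℂ)) (hqd0 : qd ≠ 0)
    (hvd : padicValRat p qd = 0) (htam : ¬ p ∣ W.tamagawaProduct)
    {k : ℕ} (hI : padicValNat p (AddSubgroup.zmultiples P).index ≤ k)
    (hdvd : p ^ (2 * k - 1) ∣ W.shaOrder) :
    BSDp W p ∧ BSDp Wd p :=
  have hpN : p ∣ W.conductorNorm ℤ :=
    (W.dvd_conductorNorm_iff_not_hasGoodReductionAtPrime p).mpr (not_good_of_addv W p hX.1.2.1)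
  bsdp_and_bsdp_twist_of_indexValuation_of_pow_dvd_of_odd_of_irr W p K Dt H ι P hGZ hKo hMN hGZK hmod
    hCT hX.p_ne_two hpN hr hX.irr hK hHN hodd hdK hP hc Wd Cd hWd qd hqd hqd0 hvd htam hI hdvd

/-- **The `k = 1` element form, NO image hypothesis** (the shape of the lane's `#Ш_an(E) = 9` rows):
X4(M), rank one, any odd `p`; index valuation `≤ 1`, unit twist value, `p ∤ ∏c_ℓ(E)`, and ONE nonzero
`x ∈ Ш(E/ℚ)` with `px = 0` (`Typed.dvd_shaOrder_of_exists_torsion`) ⇒ `BSD(E,p)` and `BSD(E^{d_K},p)`.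
Per pair; nothing booked. [cite: MatarNekovar2019, Thm. 0.3 (p. 456), §0.11 (p. 457)]
[cite: SilvermanAEC2009, Thm. X.4.14] [cite: Miller2011LMS, Def. 1.1] -/
theorem ClassX4M.bsdp_rankOne_of_indexValuation_of_exists_torsion [W.IsGloballyMinimal]
    [NeZero (W.conductorNorm ℤ)]
    (hX : ClassX4M W p) (hr : W.analyticRank = 1)
    (K : Type) [Field K] [NumberField K]
    (Dt : ModularParametrizationData W (W.conductorNorm ℤ))
    (H : HeegnerDatum (W.conductorNorm ℤ) (NumberField.discr K)) (ι : K →+* ℂ)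
    (P : (W.baseChange K).toAffine.Point)
    (hGZ : gross_zagier (W.conductorNorm ℤ) W K) (hKo : kolyvagin (W.conductorNorm ℤ) W K)
    (hMN : MatarNekovar2019.thm03_padicValNat_card_sha_le_of_irreducible (W.conductorNorm ℤ) W K)
    (hGZK : rank_eq_analyticRank_of_analyticRank_le_one) (hmod : hasEntireLFunction_rat)
    (hCT : exists_casselsTate_pairing (K := ℚ))
    (hK : IsImaginaryQuadratic K) (hHN : SatisfiesHeegnerHypothesis (W.conductorNorm ℤ) K)
    (hodd : Odd (NumberField.discr K)) (hdK : NumberField.discr K < -4)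
    (hP : WeierstrassCurve.Affine.Point.map ι.toRatAlgHom P = heegnerPointComplex Dt H)
    (hc : ¬ (p : ℤ) ∣ Dt.c)
    (Wd : WeierstrassCurve ℚ) [Wd.IsElliptic] [Wd.IsGloballyMinimal] (Cd : VariableChange ℚ)
    (hWd : Cd • W.quadraticTwist (NumberField.discr K : ℚ) = Wd)
    (qd : ℚ) (hqd : Wd.entireLFunction 1 / (Wd.realPeriodRat : ℂ) = (qd : ℂ)) (hqd0 : qd ≠ 0)
    (hvd : padicValRat p qd = 0) (htam : ¬ p ∣ W.tamagawaProduct)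
    (hI : padicValNat p (AddSubgroup.zmultiples P).index ≤ 1)
    (hx : ∃ x : W.sha, x ≠ 0 ∧ p • x = 0) :
    BSDp W p ∧ BSDp Wd p :=
  ClassX4M.bsdp_rankOne_of_indexValuation_of_pow_dvd hX hr K Dt H ι P hGZ hKo hMN hGZK hmod hCT hK hHN
    hodd hdK hP hc Wd Cd hWd qd hqd hqd0 hvd htam (k := 1) hI
    (by simpa using dvd_shaOrder_of_exists_torsion W p hx)

end Summit.BirchSwinnertonDyer.Rank1Residual.AdditivePotMult

end
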